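import Mathlib
import Summits.KontsevichZagierPeriods.KontsevichZagierPeriods.Theorems.SoloInformedDivisionExists
import Summits.KontsevichZagierPeriods.KontsevichZagierPeriods.Theorems.SoloInformedDivisionCirc
import Summits.KontsevichZagierPeriods.KontsevichZagierPeriods.Theorems.SoloInformedDivisionNeg
import HarnessLib
import HarnessLib.Audit

/-!
# Division by translation XV: the circular and negative torsion packets, hypothesis-free (solo-informed, s44)

Part XIV (`SoloInformedDivisionExists`) constructs a division chain `soloInformedDivChainOf hm hma hq`
of every order `q ≥ 1` for every real algebraic `0 < m < 1` (first-exit step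
`b = soloInformedDivStep m q`, model `sn(K(m)/q | m)`; nodes `S_j(b)`, model `sn(jK/q)`), and
derives THEOREM XXIX(i) (hyperbolic packets) with no chain hypothesis.  This file does the same
for THEOREM XXIX(ii) (CIRCULAR packets, part IX) and XXIX(iii) (NEGATIVE packets, part X): for
every real algebraic `0 < m' < 1`, every `q ≥ 1` and `0 < p < q`, with `σ = S_p(b(m', q))` the
`p`-th node of the `q`-division chain of the COMPLEMENTARY modulus `m'` (algebraic),
`m = 1 − m'`, `c = m'σ√(1−σ²)/√(1−m'σ²)` and `ζ_j` the chain's second-kind costs,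

* `Π(1 − m'σ² | m) = (1 − (pζ_q − qζ_p)/(qc))·K(m) + ((q−p)/2)/(qc)·π`
  (`soloInformed_division_circular_value`),
* `Π(−(1−σ²)/σ² | m) = a′·K(m) + b′·π` with the explicit algebraic `a′, b′` of part X
  (`soloInformed_division_negative_value`).

Together with part XIV: for every real algebraic modulus and every torsion characteristic of
every sign, the complete elliptic integral of the third kind is an explicit `ℚ̄`-linear
combination of `K` and `π` — THEOREM XXIX (i)–(iii) in KERNEL form with no input beyond
`m ∈ ℚ̄ ∩ (0,1)` and `p/q`.

References: C. G. J. Jacobi, *Fundamenta nova* (1829), §§18–21, §§49–53; A. M. Legendre,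
*Traité des fonctions elliptiques* I (1825), ch. XXIII; M. Kontsevich, D. Zagier, *Periods*
(2001), §1.2; this work (solo-informed s43–s44).
-/

noncomputable section

open Set Filter Topology
open scoped Classical

open Literature.NumberTheory.Transcendental Literature.NumberTheory.Transcendental.KZ
open Literature.ModelTheory.ExponentialFields

namespace Summit.KontsevichZagierPeriods.KontsevichZagierPeriods.Theorems

/-- **THEOREM XXIX(ii), hypothesis-free, at every torsion order (circular packets).** For every
real algebraic `0 < m' < 1`, `q ≥ 1`, `0 < p < q`, with `σ = S_p(b)` the `p`-th node of the
`q`-division chain of `m'` (algebraic), `ζ_j` its costs and `c = m'σ√(1−σ²)/√(1−m'σ²)`: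
`Π(1 − m'σ² | 1 − m') = (1 − (pζ_q − qζ_p)/(qc))·K(1 − m') + ((q−p)/2)/(qc)·π`.
[Jacobi 1829, §53; this work] -/
theorem soloInformed_division_circular_value {m' : ℝ} (hm' : m' ∈ Ioo (0:ℝ) 1)
    (hm'a : IsAlgebraic ℚ m') {q : ℕ} (hq : 1 ≤ q) {p : ℕ} (hp0 : 0 < p) (hpq : p < q)
    (PN K : IntegralRep 1) (hPNd : PN.domain = {x | x 0 ∈ Ioo (0:ℝ) 1})
    (hPNi : EqOn PN.integrand (fun x =>
      (1 - (1 - m' * soloInformedIter m' (soloInformedDivStep m' q) p ^ 2) * x 0 ^ 2)⁻¹ *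
        ((√(1 - x 0 ^ 2))⁻¹ * (√(1 - (1 - m') * x 0 ^ 2))⁻¹)) PN.domain)
    (hKd : K.domain = {x | x 0 ∈ Ioo (0:ℝ) 1})
    (hKi : EqOn K.integrand (fun x => (√(1 - x 0 ^ 2))⁻¹ * (√(1 - (1 - m') * x 0 ^ 2))⁻¹)
      K.domain) :
    IsAlgebraic ℚ (soloInformedIter m' (soloInformedDivStep m' q) p) ∧
    PN.value = (1 - ((q : ℝ) * (m' * soloInformedIter m' (soloInformedDivStep m' q) p *
        √(1 - soloInformedIter m' (soloInformedDivStep m' q) p ^ 2) /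
        √(1 - m' * soloInformedIter m' (soloInformedDivStep m' q) p ^ 2)))⁻¹ *
        ((p : ℝ) * (soloInformedDivChainOf hm' hm'a hq).zeta q -
          (q : ℝ) * (soloInformedDivChainOf hm' hm'a hq).zeta p)) * K.value +
      (((q : ℝ) * (m' * soloInformedIter m' (soloInformedDivStep m' q) p *
        √(1 - soloInformedIter m' (soloInformedDivStep m' q) p ^ 2) /
        √(1 - m' * soloInformedIter m' (soloInformedDivStep m' q) p ^ 2)))⁻¹ *
        (((q : ℝ) - (p : ℝ)) / 2)) * Real.pi :=
  ⟨(soloInformed_divChain_mem (soloInformedDivChainOf hm' hm'a hq) hm' hm'a p hpq.le).2,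
    soloInformed_divChain_circular_value (soloInformedDivChainOf hm' hm'a hq) hm' hm'a hp0 hpq
      PN K hPNd hPNi hKd hKi⟩

/-- **THEOREM XXIX(iii), hypothesis-free, at every torsion order (negative packets).** For every
real algebraic `0 < m' < 1`, `q ≥ 1`, `0 < p < q`, with `σ = S_p(b)` (algebraic), `ζ_j`, `c` as
above and `m = 1 − m'`: `Π(−(1−σ²)/σ² | m) = a′·K(m) + b′·π`,
`a′ = σ²((1−m′) + m′(1−σ²)A)/(1−m′σ²)`, `b′ = σ²m′(1−σ²)B/(1−m′σ²)`, `A = 1 − (pζ_q − qζ_p)/(qc)`,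
`B = ((q−p)/2)/(qc)`. [Jacobi 1829, §53; this work] -/
theorem soloInformed_division_negative_value {m' : ℝ} (hm' : m' ∈ Ioo (0:ℝ) 1)
    (hm'a : IsAlgebraic ℚ m') {q : ℕ} (hq : 1 ≤ q) {p : ℕ} (hp0 : 0 < p) (hpq : p < q)
    (PN K : IntegralRep 1) (hPNd : PN.domain = {x | x 0 ∈ Ioo (0:ℝ) 1})
    (hPNi : EqOn PN.integrand (fun x =>
      (1 + (1 - soloInformedIter m' (soloInformedDivStep m' q) p ^ 2) /
        soloInformedIter m' (soloInformedDivStep m' q) p ^ 2 * x 0 ^ 2)⁻¹ *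
        ((√(1 - x 0 ^ 2))⁻¹ * (√(1 - (1 - m') * x 0 ^ 2))⁻¹)) PN.domain)
    (hKd : K.domain = {x | x 0 ∈ Ioo (0:ℝ) 1})
    (hKi : EqOn K.integrand (fun x => (√(1 - x 0 ^ 2))⁻¹ * (√(1 - (1 - m') * x 0 ^ 2))⁻¹)
      K.domain) :
    IsAlgebraic ℚ (soloInformedIter m' (soloInformedDivStep m' q) p) ∧
    PN.value = soloInformedIter m' (soloInformedDivStep m' q) p ^ 2 *
        ((1 - m') / (1 - m' * soloInformedIter m' (soloInformedDivStep m' q) p ^ 2) +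
        m' * (1 - soloInformedIter m' (soloInformedDivStep m' q) p ^ 2) /
          (1 - m' * soloInformedIter m' (soloInformedDivStep m' q) p ^ 2) *
          (1 - ((q : ℝ) * (m' * soloInformedIter m' (soloInformedDivStep m' q) p *
            √(1 - soloInformedIter m' (soloInformedDivStep m' q) p ^ 2) /
            √(1 - m' * soloInformedIter m' (soloInformedDivStep m' q) p ^ 2)))⁻¹ *
            ((p : ℝ) * (soloInformedDivChainOf hm' hm'a hq).zeta q -
              (q : ℝ) * (soloInformedDivChainOf hm' hm'a hq).zeta p))) * K.value +
      soloInformedIter m' (soloInformedDivStep m' q) p ^ 2 *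
        (m' * (1 - soloInformedIter m' (soloInformedDivStep m' q) p ^ 2) /
          (1 - m' * soloInformedIter m' (soloInformedDivStep m' q) p ^ 2) *
        (((q : ℝ) * (m' * soloInformedIter m' (soloInformedDivStep m' q) p *
          √(1 - soloInformedIter m' (soloInformedDivStep m' q) p ^ 2) /
          √(1 - m' * soloInformedIter m' (soloInformedDivStep m' q) p ^ 2)))⁻¹ *
          (((q : ℝ) - (p : ℝ)) / 2))) * Real.pi :=
  ⟨(soloInformed_divChain_mem (soloInformedDivChainOf hm' hm'a hq) hm' hm'a p hpq.le).2,
    soloInformed_divChain_negative_value (soloInformedDivChainOf hm' hm'a hq) hm' hm'a hp0 hpq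
      PN K hPNd hPNi hKd hKi⟩

/-- **THE TORSION TRICHOTOMY, UNCONDITIONAL (summary).** For every real algebraic `0 < m < 1` and
every `q ≥ 1` the division chains of `m` and of `1 − m` both exist; hence at every torsion
characteristic `0 < p < q` the three packets of parts VII (hyperbolic, modulus `m`), IX
(circular) and X (negative, modulus `1 − m` read through the complementary chain) are all
available with no hypothesis. [this work] -/
theorem soloInformed_division_chains_both {m : ℝ} (hm : m ∈ Ioo (0:ℝ) 1) (hma : IsAlgebraic ℚ m)
    {q : ℕ} (hq : 1 ≤ q) :
    Nonempty (SoloInformedDivChain m q) ∧ Nonempty (SoloInformedDivChain (1 - m) q) :=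
  ⟨soloInformed_nonempty_divChain hm hma hq,
    soloInformed_nonempty_divChain ⟨by linarith [hm.2], by linarith [hm.1]⟩
      (isAlgebraic_one.sub hma) hq⟩

end Summit.KontsevichZagierPeriods.KontsevichZagierPeriods.Theorems

end
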